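import Literature.AlgebraicGeometry.HodgeTheory.TransvectionMonodromyZariskiDense
import Literature.AlgebraicGeometry.HodgeTheory.ZariskiClosureFiniteIndex
import HarnessLib

/-!
# Deligne's one-orbit lemma, orthogonal case: the algebraic group generated by the reflections along a
# single spanning orbit of roots is finite or the full orthogonal group (Weil II, Lemme (4.4.2^β); named fact)

Family `hodge`, layer `Literature/AlgebraicGeometry/HodgeTheory`. Companion of
`SymplecticTransvectionGroupDensity.lean` (Lemme (4.4.2^α), the symplectic case, proved there) and
`TransvectionMonodromyZariskiDense.lean` (Zariski closures `glZariskiClosure Γ` of subgroups of `GL(V)` on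
`K`-points; `isometry_of_mem_glZariskiClosure`). Written by the literature-typing seat `littype-FH1-2`
(cell `hodge-nonav`) as the print input "reflection-group dichotomy" of the EVEN-dimensional big-monodromy
arguments of the cell (memo ROUTE-P3v17 ADD2 §2 STEPs 3–5 / ADD5 §4 BASE for `T_♮ = H²_prim` of quartic
surfaces: "a Picard–Lefschetz reflection in a vanishing class … Zariski closure `⊇ SO` by the
reflection-group dichotomy"), where the vanishing cycles have self-intersection `±2` and the local
monodromies are reflections, not transvections.

Source, read (held text `paper:doi-10-1007-bf02684780`, PDF p. 93 = journal p. 228; P. Deligne,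
*La conjecture de Weil : II*, Publ. Math. IHÉS 52 (1980), §4.4 "La monodromie des pinceaux de Lefschetz"):

> **Lemme (4.4.2^β).** Soit `V` un `ℂ`-espace vectoriel de dimension finie muni d'une forme bilinéaire
> symétrique non dégénérée `( , )`, `M` un sous-groupe algébrique de `O(V)` et `R` une orbite de `M` dans
> `V`, qui engendre `V`. On suppose que les éléments de `R` satisfont à `(δ, δ) = 2`, et que `M` est le
> plus petit sous-groupe algébrique de `O(V)` contenant les réflexions `s_δ : x ↦ x - (x, δ) δ` pour
> `δ ∈ R`. Alors, `M` est fini ou `M = O(V)`.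

(Proof: loc. cit. (4.4.3^β)–(4.4.4^β), pp. 228–229. Use in the text, p. 227: Thm. (4.4.1) — for a
Lefschetz pencil with even fibre dimension `n` the monodromy group `M` on the vanishing part is "ouvert
dans `G`" or finite — is obtained by applying (4.4.2^β) "à la clôture de Zariski de `M` dans `G(ℚ_ℓ)` et
à la classe de conjugaison des transformations de Picard–Lefschetz"; the finite case is analysed in
Thm. (4.4.9), p. 230: the `±δ` form a root system of type `A`, `D` or `E` and `M` is its Weyl group.)

## Rendering

* `orthoReflection B δ : V →ₗ[K] V` — Deligne's `s_δ : x ↦ x - (x, δ) δ` (the tree's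
  `oneParamTransvection B δ (-1)` for a SYMMETRIC form); for `(δ, δ) = 2` it is an involutive
  `B`-isometry with `s_δ(δ) = -δ` (PROVED: `orthoReflection_orthoReflection`, `orthoReflection_isometry`,
  `orthoReflection_apply_self`), packaged as the automorphism `orthoReflectionEquiv B hδ`.
* `reflectionGroup B R ≤ GL(V)` — the subgroup generated by the automorphisms whose underlying map is
  `s_δ`, `δ ∈ R` (an abstract group; for a root `δ` of infinite reflection groups this is NOT an
  algebraic group, unlike the unipotent case of (4.4.2^α)).
* Deligne's `M` = "le plus petit sous-groupe algébrique de `O(V)` contenant les réflexions `s_δ`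
  (`δ ∈ R`)" is rendered on `ℂ`-points as the Zariski closure `glZariskiClosure (reflectionGroup B R)`
  (`AlgebraicMonodromyMumfordTate`: every polynomial in the matrix entries vanishing on the group
  vanishes at `g`); "`R` une orbite de `M`" = `M`-stable and `M`-transitive; "`M` est fini" = this set of
  `ℂ`-points is finite; "`M = O(V)`" pointwise: `g ∈ M ↔ g` preserves `( , )`. That every element of `M`
  preserves `( , )` holds unconditionally and is PROVED (`isometry_of_mem_glZariskiClosure_reflectionGroup`:
  `O(V)` is Zariski closed, `isometry_of_mem_glZariskiClosure`).
* NAMED FACT `Deligne1980_reflectionGroupClosure_finite_or_orthogonal` — Lemme (4.4.2^β) as printed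
  (field `ℂ`); consumer form `….mem_of_isometry_of_infinite`: if `M` is infinite, every isometry lies in
  `M` (PROVED from the fact).

Not here: the proof ((4.4.3^β)–(4.4.4^β): density of `R ∩ W` in the sphere `(x, x) = 2` of a maximal
subspace `W`, and the trichotomy a)/b)/c) for the linear form `(δ, ·)` on that sphere); Thm. (4.4.9)
(finite case = Weyl group of an `ADE` root system); the geometric theorem (4.4.1) itself, whose
hypotheses for the universal families of hypersurfaces are the Picard–Lefschetz facts of
`PicardLefschetzNodalForms` / `LefschetzMonodromy`.

## Part II (appended): the orbit condition for the ABSTRACT reflection group (Carlson–Toledo's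
## formulation of Deligne's theorem), PROVED from the named fact

Carlson–Toledo, *Discriminant complements and kernels of monodromy representations* (1999), §3 (held text
`paper:arxiv-alg-geom_9708002` p0007), quote Deligne's lemma in the form monodromy arguments use:
"**Theorem (Deligne).** Let `V` be a vector space (over `ℂ`) with a non-degenerate bilinear form `( , )`
which is either symmetric or skew-symmetric. Let `Γ` be a group of linear transformations of `V` which
preserves the bilinear form. Assume the existence of a subset `E ⊂ V` such that `Γ` is generated by the
Picard–Lefschetz transformations with `δ ∈ E`. Suppose that `E` consists of a single `Γ`-orbit and that it
spans `V`. Then `Γ` is either finite or Zariski-dense." Here the orbit condition is on the abstract group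
`Γ = Γ_E` generated by the reflections, not on its Zariski closure `M`. §4–§5 below DERIVE this form
(symmetric case) from `Deligne1980_reflectionGroupClosure_finite_or_orthogonal`: apply the fact to the
`M`-saturation `R = M · E`, which consists of roots (`M ⊆ O(V)`), spans, is one `M`-orbit (transitivity of
`Γ_E` on `E` and `Γ_E ⊆ M`), and has the same closure: `Γ_E ≤ Γ_R` and `Γ_R ≤ M` because
`s_{gδ} = g s_δ g⁻¹` (`conj_orthoReflectionEquiv`) and `M` is a subgroup (`GlZariskiClosureGroup`), whence
`closure Γ_R ⊆ closure M = M` (idempotence, `ZariskiClosureFiniteIndex.glZariskiClosure_glZariskiClosureSubgroup`).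
Only TRANSITIVITY of `Γ_E` on `E` is needed (not `Γ_E`-stability). Results:
`Deligne1980_reflectionGroupClosure_finite_or_orthogonal.of_orbit` (finite or `= O(V)`),
`….mem_of_isometry_of_orbit_of_infinite`, `….mem_iff_isometry_of_orbit_of_infinite`.

## References

* [Deligne1980] P. Deligne, La conjecture de Weil : II, Publ. Math. IHÉS 52 (1980) 137–252, §4.4,
  Lemme (4.4.2^β) p. 228, proof (4.4.3^β)–(4.4.4^β) pp. 228–229, Thm. (4.4.1) p. 227, Thm. (4.4.9) p. 230
  (held text PDF pp. 92–95).
* [CarlsonMullerStachPeters2017] J. Carlson, S. Müller-Stach, C. Peters, Period Mappings and Period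
  Domains, 2nd ed. (2017), Lemma–Definition 15.3.7 (`Γ^Zar`; the tree's `glZariskiClosure`).
* [CarlsonToledo1999] J. A. Carlson, D. Toledo, Discriminant complements and kernels of monodromy
  representations, Duke Math. J. 97 (1999), §3 "Theorem (Deligne)" (held text p0007).
* [Borel1991] A. Borel, Linear Algebraic Groups, 2nd ed., I.2.1 (the closure of a subgroup is a subgroup;
  tree `GlZariskiClosureGroup`, `ZariskiClosureFiniteIndex`).
-/

noncomputable section

namespace Literature.AlgebraicGeometry.HodgeTheory

/-! ## §1 Reflections along roots of a symmetric form -/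

section Reflections

variable {K : Type*} [Field K] {V : Type*} [AddCommGroup V] [Module K V] (B : LinearMap.BilinForm K V)

/-- Deligne's **reflection** `s_δ : x ↦ x - (x, δ) δ` along `δ` (for `(δ, δ) = 2` the orthogonal
reflection in the hyperplane `δ^⊥`): the tree's `oneParamTransvection B δ (-1)`, now for a symmetric
form. [cite: Deligne1980, §4.4 Lemme (4.4.2^β) p. 228] -/
def orthoReflection (δ : V) : V →ₗ[K] V :=
  oneParamTransvection B δ (-1)

/-- `s_δ(x) = x - (x, δ) δ`. [cite: Deligne1980, §4.4 Lemme (4.4.2^β) p. 228] -/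
@[simp]
theorem orthoReflection_apply (δ x : V) : orthoReflection B δ x = x - (B x δ) • δ := by
  rw [orthoReflection, oneParamTransvection_apply, neg_one_mul, neg_smul, sub_eq_add_neg]

/-- `s_δ = U_δ(-1)` (unfolding). [cite: Deligne1980, §4.4 Lemme (4.4.2^α)–(4.4.2^β) pp. 227–228] -/
theorem orthoReflection_eq_oneParamTransvection (δ : V) :
    orthoReflection B δ = oneParamTransvection B δ (-1) := rfl

/-- A root is sent to its negative: `s_δ(δ) = -δ` when `(δ, δ) = 2`. [cite: Deligne1980, §4.4 (4.4.3^β) p. 228 ("`s_{δ'}(δ') = -δ'`")] -/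
theorem orthoReflection_apply_self {δ : V} (hδ : B δ δ = 2) : orthoReflection B δ δ = -δ := by
  rw [orthoReflection_apply, hδ, two_smul]
  abel

/-- `s_δ` fixes the vectors orthogonal to `δ`. [cite: Deligne1980, §4.4 Lemme (4.4.2^β) p. 228] -/
theorem orthoReflection_apply_of_orthogonal {δ x : V} (hx : B x δ = 0) : orthoReflection B δ x = x := by
  rw [orthoReflection_apply, hx, zero_smul, sub_zero]

/-- `(s_δ x, δ) = -(x, δ)` when `(δ, δ) = 2`. [cite: Deligne1980, §4.4 Lemme (4.4.2^β) p. 228] -/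
theorem apply_orthoReflection_self {δ : V} (hδ : B δ δ = 2) (x : V) :
    B (orthoReflection B δ x) δ = -(B x δ) := by
  rw [orthoReflection_apply, map_sub, LinearMap.sub_apply, map_smul, LinearMap.smul_apply, smul_eq_mul,
    hδ]
  ring

/-- `s_δ` is an involution when `(δ, δ) = 2`: `s_δ (s_δ x) = x`. [cite: Deligne1980, §4.4 Lemme (4.4.2^β) p. 228] -/
theorem orthoReflection_orthoReflection {δ : V} (hδ : B δ δ = 2) (x : V) :
    orthoReflection B δ (orthoReflection B δ x) = x := by
  rw [orthoReflection_apply B δ (orthoReflection B δ x), apply_orthoReflection_self B hδ,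
    orthoReflection_apply, neg_smul, sub_neg_eq_add, sub_add_cancel]

/-- `s_δ ∘ s_δ = id` when `(δ, δ) = 2`. [cite: Deligne1980, §4.4 Lemme (4.4.2^β) p. 228] -/
theorem orthoReflection_comp_self {δ : V} (hδ : B δ δ = 2) :
    orthoReflection B δ ∘ₗ orthoReflection B δ = LinearMap.id :=
  LinearMap.ext (orthoReflection_orthoReflection B hδ)

/-- **Reflections along roots are isometries** of a symmetric form: `(s_δ x, s_δ y) = (x, y)` when
`(δ, δ) = 2` ("`il respecte la forme bilinéaire`"). [cite: Deligne1980, §4.4 Lemme (4.4.2^β) p. 228] -/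
theorem orthoReflection_isometry (hB : B.IsSymm) {δ : V} (hδ : B δ δ = 2) (x y : V) :
    B (orthoReflection B δ x) (orthoReflection B δ y) = B x y := by
  have h1 : B δ y = B y δ := hB.eq δ y
  simp only [orthoReflection_apply, map_sub, map_smul, LinearMap.sub_apply, LinearMap.smul_apply,
    smul_eq_mul, hδ, h1]
  ring

/-- The reflection `s_δ`, `(δ, δ) = 2`, as a linear automorphism of `V` (its own inverse).
[cite: Deligne1980, §4.4 Lemme (4.4.2^β) p. 228] -/
def orthoReflectionEquiv {δ : V} (hδ : B δ δ = 2) : V ≃ₗ[K] V :=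
  LinearEquiv.ofLinear (orthoReflection B δ) (orthoReflection B δ)
    (orthoReflection_comp_self B hδ) (orthoReflection_comp_self B hδ)

/-- The underlying linear map of `orthoReflectionEquiv` is `s_δ` (unfolding). [cite: Deligne1980, §4.4 Lemme (4.4.2^β) p. 228] -/
@[simp]
theorem coe_orthoReflectionEquiv {δ : V} (hδ : B δ δ = 2) :
    (orthoReflectionEquiv B hδ : V →ₗ[K] V) = orthoReflection B δ := rfl

/-- `orthoReflectionEquiv` acts as `s_δ`. [cite: Deligne1980, §4.4 Lemme (4.4.2^β) p. 228] -/
@[simp]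
theorem orthoReflectionEquiv_apply {δ : V} (hδ : B δ δ = 2) (x : V) :
    orthoReflectionEquiv B hδ x = x - (B x δ) • δ :=
  orthoReflection_apply B δ x

/-! ## §2 The group generated by the reflections along `R`, and its Zariski closure `M` -/

/-- **The reflection group `Γ_R ≤ GL(V)`**: the subgroup generated by the automorphisms of `V` whose
underlying linear map is a reflection `s_δ`, `δ ∈ R` (Deligne: "les réflexions `s_δ` pour `δ ∈ R`";
Beauville's `Γ_Δ`). Its Zariski closure `glZariskiClosure (reflectionGroup B R)` is Deligne's `M`, "le plus
petit sous-groupe algébrique de `O(V)` contenant les réflexions `s_δ` (`δ ∈ R`)", on `K`-points.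
[cite: Deligne1980, §4.4 Lemme (4.4.2^β) p. 228] -/
def reflectionGroup (R : Set V) : Subgroup (V ≃ₗ[K] V) :=
  Subgroup.closure {g | ∃ δ ∈ R, (g : V →ₗ[K] V) = orthoReflection B δ}

/-- `Γ_R` is monotone in `R`. [cite: Deligne1980, §4.4 Lemme (4.4.2^β) p. 228] -/
theorem reflectionGroup_mono {R R' : Set V} (h : R ⊆ R') : reflectionGroup B R ≤ reflectionGroup B R' :=
  Subgroup.closure_mono fun _ ⟨δ, hδ, hg⟩ => ⟨δ, h hδ, hg⟩

/-- For a root `δ ∈ R`, `(δ, δ) = 2`, the reflection `s_δ` lies in `Γ_R`. [cite: Deligne1980, §4.4 Lemme (4.4.2^β) p. 228] -/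
theorem orthoReflectionEquiv_mem_reflectionGroup {R : Set V} {δ : V} (hδR : δ ∈ R) (hδ : B δ δ = 2) :
    orthoReflectionEquiv B hδ ∈ reflectionGroup B R :=
  Subgroup.subset_closure ⟨δ, hδR, rfl⟩

/-- **`Γ_R ⊆ O(V)`**: when `R` consists of roots (`(δ, δ) = 2` on `R`) of a symmetric form, every element
of the reflection group preserves the form. [cite: Deligne1980, §4.4 Lemme (4.4.2^β) p. 228 ("`M` un sous-groupe algébrique de `O(V)`")] -/
theorem reflectionGroup_isometry (hB : B.IsSymm) {R : Set V} (hR : ∀ δ ∈ R, B δ δ = 2)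
    {g : V ≃ₗ[K] V} (hg : g ∈ reflectionGroup B R) (x y : V) : B (g x) (g y) = B x y := by
  induction hg using Subgroup.closure_induction generalizing x y with
  | mem g hg =>
    obtain ⟨δ, hδR, hg⟩ := hg
    have h := orthoReflection_isometry B hB (hR δ hδR) x y
    rw [← hg] at h
    exact h
  | one => rfl
  | mul g h _ _ hg hh => rw [LinearEquiv.mul_apply, LinearEquiv.mul_apply, hg, hh]
  | inv g _ hg =>
    have key := hg (g.symm x) (g.symm y)
    rw [LinearEquiv.apply_symm_apply, LinearEquiv.apply_symm_apply] at key
    rw [LinearEquiv.coe_inv]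
    exact key.symm

variable [FiniteDimensional K V]

/-- **`M ⊆ O(V)`**: every element of the Zariski closure `M` of the reflection group of a set of roots
preserves the (symmetric) form — `O(V)` is Zariski closed (`isometry_of_mem_glZariskiClosure`). This is
the unconditional half of "`M = O(V)`". [cite: Deligne1980, §4.4 Lemme (4.4.2^β) p. 228] [cite: CarlsonMullerStachPeters2017, Lemma–Definition 15.3.7] -/
theorem isometry_of_mem_glZariskiClosure_reflectionGroup (hB : B.IsSymm) {R : Set V}
    (hR : ∀ δ ∈ R, B δ δ = 2) {g : V ≃ₗ[K] V} (hg : g ∈ glZariskiClosure (reflectionGroup B R))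
    (x y : V) : B (g x) (g y) = B x y :=
  isometry_of_mem_glZariskiClosure (fun _ hh => reflectionGroup_isometry B hB hR hh) hg x y

end Reflections

/-! ## §3 The named fact and its consumer form -/

section Deligne

/-- **Deligne's one-orbit lemma, orthogonal case** (Weil II, Lemme (4.4.2^β); named fact). Let `V` be a
finite-dimensional `ℂ`-vector space with a non-degenerate symmetric bilinear form `( , )`, `R ⊆ V` a set
of vectors with `(δ, δ) = 2` spanning `V`, and `M = glZariskiClosure (reflectionGroup B R)` the Zariski
closure (on `ℂ`-points) of the group generated by the reflections `s_δ : x ↦ x - (x, δ) δ`, `δ ∈ R` — the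
smallest algebraic subgroup of `O(V)` containing them; assume `R` is a single orbit of `M` (`M`-stable and
`M`-transitive). Then `M` is finite, or `M = O(V)`: an automorphism of `V` lies in `M` iff it preserves
`( , )`. Printed: "Soit `V` un `ℂ`-espace vectoriel de dimension finie muni d'une forme bilinéaire
symétrique non dégénérée `( , )`, `M` un sous-groupe algébrique de `O(V)` et `R` une orbite de `M` dans
`V`, qui engendre `V`. On suppose que les éléments de `R` satisfont à `(δ, δ) = 2`, et que `M` est le
plus petit sous-groupe algébrique de `O(V)` contenant les réflexions `s_δ : x ↦ x - (x, δ) δ` pour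
`δ ∈ R`. Alors, `M` est fini ou `M = O(V)`."
[cite: Deligne1980, §4.4 Lemme (4.4.2^β) p. 228 (held text PDF p. 93)] -/
def Deligne1980_reflectionGroupClosure_finite_or_orthogonal : Prop :=
  ∀ (V : Type) [AddCommGroup V] [Module ℂ V] [FiniteDimensional ℂ V] (B : LinearMap.BilinForm ℂ V),
    B.IsSymm → B.Nondegenerate → ∀ R : Set V, (∀ δ ∈ R, B δ δ = 2) → Submodule.span ℂ R = ⊤ →
      (∀ g ∈ glZariskiClosure (reflectionGroup B R), ∀ δ ∈ R, g δ ∈ R) →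
      (∀ δ ∈ R, ∀ δ' ∈ R, ∃ g ∈ glZariskiClosure (reflectionGroup B R), g δ = δ') →
        (glZariskiClosure (reflectionGroup B R)).Finite ∨
          ∀ g : V ≃ₗ[ℂ] V, g ∈ glZariskiClosure (reflectionGroup B R) ↔ ∀ x y : V, B (g x) (g y) = B x y

/-- **Consumer form**: under the hypotheses of Lemme (4.4.2^β), if `M` is INFINITE then `M = O(V)` —
every isometry of `( , )` lies in the Zariski closure of the reflection group (the alternative used for
big-monodromy conclusions: an infinite monodromy group generated by Picard–Lefschetz reflections along
one spanning orbit of vanishing cycles is Zariski dense in `O`). [cite: Deligne1980, §4.4 Lemme (4.4.2^β) p. 228 and Thm. (4.4.1) p. 227] -/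
theorem Deligne1980_reflectionGroupClosure_finite_or_orthogonal.mem_of_isometry_of_infinite
    (h : Deligne1980_reflectionGroupClosure_finite_or_orthogonal) {V : Type} [AddCommGroup V] [Module ℂ V]
    [FiniteDimensional ℂ V] {B : LinearMap.BilinForm ℂ V} (hB : B.IsSymm) (hBn : B.Nondegenerate)
    {R : Set V} (hR : ∀ δ ∈ R, B δ δ = 2) (hsp : Submodule.span ℂ R = ⊤)
    (hst : ∀ g ∈ glZariskiClosure (reflectionGroup B R), ∀ δ ∈ R, g δ ∈ R)
    (htr : ∀ δ ∈ R, ∀ δ' ∈ R, ∃ g ∈ glZariskiClosure (reflectionGroup B R), g δ = δ')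
    (hinf : (glZariskiClosure (reflectionGroup B R)).Infinite)
    {g : V ≃ₗ[ℂ] V} (hg : ∀ x y : V, B (g x) (g y) = B x y) :
    g ∈ glZariskiClosure (reflectionGroup B R) := by
  rcases h V B hB hBn R hR hsp hst htr with hfin | hO
  · exact absurd hfin hinf
  · exact (hO g).2 hg

/-- **Consumer form, as an equality of sets**: under the hypotheses of Lemme (4.4.2^β) with `M` infinite,
`M` is exactly the set of isometries of `( , )` ("`M = O(V)`" on `ℂ`-points).
[cite: Deligne1980, §4.4 Lemme (4.4.2^β) p. 228] -/
theorem Deligne1980_reflectionGroupClosure_finite_or_orthogonal.mem_iff_isometry_of_infinite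
    (h : Deligne1980_reflectionGroupClosure_finite_or_orthogonal) {V : Type} [AddCommGroup V] [Module ℂ V]
    [FiniteDimensional ℂ V] {B : LinearMap.BilinForm ℂ V} (hB : B.IsSymm) (hBn : B.Nondegenerate)
    {R : Set V} (hR : ∀ δ ∈ R, B δ δ = 2) (hsp : Submodule.span ℂ R = ⊤)
    (hst : ∀ g ∈ glZariskiClosure (reflectionGroup B R), ∀ δ ∈ R, g δ ∈ R)
    (htr : ∀ δ ∈ R, ∀ δ' ∈ R, ∃ g ∈ glZariskiClosure (reflectionGroup B R), g δ = δ')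
    (hinf : (glZariskiClosure (reflectionGroup B R)).Infinite) (g : V ≃ₗ[ℂ] V) :
    g ∈ glZariskiClosure (reflectionGroup B R) ↔ ∀ x y : V, B (g x) (g y) = B x y :=
  ⟨fun hg => isometry_of_mem_glZariskiClosure_reflectionGroup B hB hR hg,
    fun hg => h.mem_of_isometry_of_infinite hB hBn hR hsp hst htr hinf hg⟩

end Deligne

/-! ## Part II, §4 Conjugates of reflections -/

section Conjugation

variable {K : Type*} [Field K] {V : Type*} [AddCommGroup V] [Module K V] (B : LinearMap.BilinForm K V)

/-- An isometry carries roots to roots: `(gδ, gδ) = (δ, δ) = 2`. [cite: Deligne1980, §4.4 Lemme (4.4.2^β) p. 228] -/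
theorem apply_apply_eq_two_of_isometry {g : V ≃ₗ[K] V} (hg : ∀ x y : V, B (g x) (g y) = B x y) {δ : V}
    (hδ : B δ δ = 2) : B (g δ) (g δ) = 2 := by
  rw [hg, hδ]

/-- `orthoReflectionEquiv` acts as `orthoReflection` (pointwise unfolding). [cite: Deligne1980, §4.4 Lemme (4.4.2^β) p. 228] -/
theorem orthoReflectionEquiv_apply_eq_orthoReflection {δ : V} (hδ : B δ δ = 2) (x : V) :
    orthoReflectionEquiv B hδ x = orthoReflection B δ x := rfl

/-- **Conjugating a reflection by an isometry**, on vectors: `g (s_δ (g⁻¹ x)) = s_{gδ}(x)`.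
[cite: Deligne1980, §4.4 (4.4.4^β) p. 228] [cite: CarlsonToledo1999, §3 Theorem (Deligne) (held text p0007)] -/
theorem apply_orthoReflection_symm_apply {g : V ≃ₗ[K] V} (hg : ∀ x y : V, B (g x) (g y) = B x y)
    (δ x : V) : g (orthoReflection B δ (g.symm x)) = orthoReflection B (g δ) x := by
  have hB : B (g.symm x) δ = B x (g δ) := by
    rw [← hg (g.symm x) δ, LinearEquiv.apply_symm_apply]
  rw [orthoReflection_apply, orthoReflection_apply, map_sub, LinearEquiv.map_smul,
    LinearEquiv.apply_symm_apply, hB]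

/-- **`g s_δ g⁻¹ = s_{gδ}`** in `GL(V)` for an isometry `g` and a root `δ` (the reflections along one orbit
are conjugate). [cite: Deligne1980, §4.4 (4.4.4^β) p. 228] [cite: CarlsonToledo1999, §3 Theorem (Deligne) (held text p0007)] -/
theorem conj_orthoReflectionEquiv {g : V ≃ₗ[K] V} (hg : ∀ x y : V, B (g x) (g y) = B x y) {δ : V}
    (hδ : B δ δ = 2) :
    g * orthoReflectionEquiv B hδ * g⁻¹ =
      orthoReflectionEquiv B (apply_apply_eq_two_of_isometry B hg hδ) := by
  refine LinearEquiv.ext fun x => ?_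
  rw [LinearEquiv.mul_apply, LinearEquiv.mul_apply, LinearEquiv.coe_inv,
    orthoReflectionEquiv_apply_eq_orthoReflection, orthoReflectionEquiv_apply_eq_orthoReflection,
    apply_orthoReflection_symm_apply B hg]

/-- An automorphism whose underlying linear map is `s_δ`, `(δ, δ) = 2`, IS `orthoReflectionEquiv B hδ`.
[cite: Deligne1980, §4.4 Lemme (4.4.2^β) p. 228] -/
theorem eq_orthoReflectionEquiv_of_coe_eq {g : V ≃ₗ[K] V} {δ : V} (hδ : B δ δ = 2)
    (hg : (g : V →ₗ[K] V) = orthoReflection B δ) : g = orthoReflectionEquiv B hδ :=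
  LinearEquiv.toLinearMap_injective (hg.trans (coe_orthoReflectionEquiv B hδ).symm)

end Conjugation

/-! ## Part II, §5 Deligne's dichotomy under the orbit condition for the abstract group `Γ_E`
(Carlson–Toledo's formulation), proved from the named fact -/

section Orbit

variable {K : Type*} [Field K] {V : Type*} [AddCommGroup V] [Module K V] [FiniteDimensional K V]
  (B : LinearMap.BilinForm K V)

/-- **The `M`-saturation of `E` generates a reflection group inside `M`**: for `E` a set of roots of a
symmetric form and `M = glZariskiClosure (reflectionGroup B E)`, the reflection group of
`R = M · E = {g δ | g ∈ M, δ ∈ E}` is contained in `M` (each generator `s_{gδ} = g s_δ g⁻¹` lies in the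
subgroup `M`). [cite: Borel1991, I.2.1] [cite: Deligne1980, §4.4 (4.4.4^β) p. 228] -/
theorem reflectionGroup_saturation_le (hB : B.IsSymm) {E : Set V} (hE : ∀ δ ∈ E, B δ δ = 2) :
    reflectionGroup B {v | ∃ g ∈ glZariskiClosure (reflectionGroup B E), ∃ δ ∈ E, g δ = v} ≤
      glZariskiClosureSubgroup (reflectionGroup B E) := by
  rw [reflectionGroup]
  refine (Subgroup.closure_le _).2 ?_
  rintro g' ⟨v, ⟨g, hg, δ, hδ, rfl⟩, hg'⟩
  have hgi : ∀ x y : V, B (g x) (g y) = B x y :=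
    isometry_of_mem_glZariskiClosure_reflectionGroup B hB hE hg
  have key : g' = g * orthoReflectionEquiv B (hE δ hδ) * g⁻¹ := by
    rw [conj_orthoReflectionEquiv B hgi (hE δ hδ)]
    exact eq_orthoReflectionEquiv_of_coe_eq B _ hg'
  rw [key]
  have hgM : g ∈ glZariskiClosureSubgroup (reflectionGroup B E) :=
    (mem_glZariskiClosureSubgroup_iff _ g).2 hg
  exact Subgroup.mul_mem _ (Subgroup.mul_mem _ hgM (le_glZariskiClosureSubgroup _
    (orthoReflectionEquiv_mem_reflectionGroup B hδ (hE δ hδ)))) (Subgroup.inv_mem _ hgM)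

/-- **The saturation does not change the Zariski closure**: with `R = M · E` as above,
`glZariskiClosure (reflectionGroup B R) = M` (`Γ_E ≤ Γ_R ≤ M` and idempotence of the closure).
[cite: Borel1991, I.2.1] [cite: CarlsonMullerStachPeters2017, Lemma–Definition 15.3.7] -/
theorem glZariskiClosure_reflectionGroup_saturation (hB : B.IsSymm) {E : Set V}
    (hE : ∀ δ ∈ E, B δ δ = 2) :
    glZariskiClosure (reflectionGroup B {v | ∃ g ∈ glZariskiClosure (reflectionGroup B E), ∃ δ ∈ E, g δ = v}) =
      glZariskiClosure (reflectionGroup B E) := by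
  refine Set.Subset.antisymm ?_ ?_
  · exact (glZariskiClosure_mono (reflectionGroup_saturation_le B hB hE)).trans
      (glZariskiClosure_glZariskiClosureSubgroup _).subset
  · exact glZariskiClosure_mono (reflectionGroup_mono B fun δ hδ =>
      ⟨1, one_mem_glZariskiClosure _, δ, hδ, rfl⟩)

/-- **Deligne's dichotomy, Carlson–Toledo's formulation** (PROVED from the named fact). Let `V` be a
finite-dimensional `ℂ`-vector space with a non-degenerate symmetric form `( , )`, `E ⊆ V` a spanning set
of roots (`(δ, δ) = 2`) on which the reflection group `Γ_E = reflectionGroup B E` (generated by the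
`s_δ`, `δ ∈ E`) acts TRANSITIVELY. Then the Zariski closure `M` of `Γ_E` is finite, or `M = O(V)` (an
automorphism lies in `M` iff it preserves the form). Printed (CT99 §3): "Let `Γ` be a group of linear
transformations of `V` which preserves the bilinear form. Assume the existence of a subset `E ⊂ V` such that
`Γ` is generated by the Picard–Lefschetz transformations with `δ ∈ E`. Suppose that `E` consists of a single
`Γ`-orbit and that it spans `V`. Then `Γ` is either finite or Zariski-dense." (Proof: the fact applied to
`R = M · E`, `glZariskiClosure_reflectionGroup_saturation`.)
[cite: CarlsonToledo1999, §3 Theorem (Deligne) (held text p0007)] [cite: Deligne1980, §4.4 Lemme (4.4.2^β) p. 228] -/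
theorem Deligne1980_reflectionGroupClosure_finite_or_orthogonal.of_orbit
    (h : Deligne1980_reflectionGroupClosure_finite_or_orthogonal) {V : Type} [AddCommGroup V] [Module ℂ V]
    [FiniteDimensional ℂ V] {B : LinearMap.BilinForm ℂ V} (hB : B.IsSymm) (hBn : B.Nondegenerate)
    {E : Set V} (hE : ∀ δ ∈ E, B δ δ = 2) (hsp : Submodule.span ℂ E = ⊤)
    (htr : ∀ δ ∈ E, ∀ δ' ∈ E, ∃ γ ∈ reflectionGroup B E, γ δ = δ') :
    (glZariskiClosure (reflectionGroup B E)).Finite ∨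
      ∀ g : V ≃ₗ[ℂ] V, g ∈ glZariskiClosure (reflectionGroup B E) ↔ ∀ x y : V, B (g x) (g y) = B x y := by
  set R : Set V := {v | ∃ g ∈ glZariskiClosure (reflectionGroup B E), ∃ δ ∈ E, g δ = v} with hRdef
  have hMiso : ∀ g ∈ glZariskiClosure (reflectionGroup B E), ∀ x y : V, B (g x) (g y) = B x y :=
    fun g hg => isometry_of_mem_glZariskiClosure_reflectionGroup B hB hE hg
  have hRroot : ∀ v ∈ R, B v v = 2 := by
    rintro _ ⟨g, hg, δ, hδ, rfl⟩
    rw [hMiso g hg, hE δ hδ]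
  have hER : E ⊆ R := fun δ hδ => ⟨1, one_mem_glZariskiClosure _, δ, hδ, rfl⟩
  have hRsp : Submodule.span ℂ R = ⊤ :=
    top_le_iff.1 (hsp ▸ Submodule.span_mono hER)
  have hMeq : glZariskiClosure (reflectionGroup B R) = glZariskiClosure (reflectionGroup B E) :=
    glZariskiClosure_reflectionGroup_saturation B hB hE
  have hst : ∀ g ∈ glZariskiClosure (reflectionGroup B R), ∀ v ∈ R, g v ∈ R := by
    intro g hg v hv
    rw [hMeq] at hg
    obtain ⟨g', hg', δ, hδ, rfl⟩ := hv
    exact ⟨g * g', mul_mem_glZariskiClosure hg hg', δ, hδ, rfl⟩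
  have htr' : ∀ v ∈ R, ∀ v' ∈ R, ∃ g ∈ glZariskiClosure (reflectionGroup B R), g v = v' := by
    rintro _ ⟨g, hg, δ, hδ, rfl⟩ _ ⟨g', hg', δ', hδ', rfl⟩
    obtain ⟨γ, hγ, hγδ⟩ := htr δ hδ δ' hδ'
    refine ⟨g' * γ * g⁻¹, ?_, ?_⟩
    · rw [hMeq]
      exact mul_mem_glZariskiClosure (mul_mem_glZariskiClosure hg' (subset_glZariskiClosure _ hγ))
        (inv_mem_glZariskiClosure hg)
    · rw [LinearEquiv.mul_apply, LinearEquiv.mul_apply, LinearEquiv.coe_inv, LinearEquiv.symm_apply_apply,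
        hγδ]
  have key := h V B hB hBn R hRroot hRsp hst htr'
  rw [hMeq] at key
  exact key

/-- **Consumer form (orbit condition on `Γ_E`)**: under the hypotheses of `….of_orbit`, if the Zariski
closure `M` of the reflection group is infinite, every isometry lies in `M` ("`Γ` is Zariski-dense").
[cite: CarlsonToledo1999, §3 Theorem (Deligne) (held text p0007)] [cite: Deligne1980, §4.4 Lemme (4.4.2^β) p. 228] -/
theorem Deligne1980_reflectionGroupClosure_finite_or_orthogonal.mem_of_isometry_of_orbit_of_infinite
    (h : Deligne1980_reflectionGroupClosure_finite_or_orthogonal) {V : Type} [AddCommGroup V] [Module ℂ V]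
    [FiniteDimensional ℂ V] {B : LinearMap.BilinForm ℂ V} (hB : B.IsSymm) (hBn : B.Nondegenerate)
    {E : Set V} (hE : ∀ δ ∈ E, B δ δ = 2) (hsp : Submodule.span ℂ E = ⊤)
    (htr : ∀ δ ∈ E, ∀ δ' ∈ E, ∃ γ ∈ reflectionGroup B E, γ δ = δ')
    (hinf : (glZariskiClosure (reflectionGroup B E)).Infinite)
    {g : V ≃ₗ[ℂ] V} (hg : ∀ x y : V, B (g x) (g y) = B x y) :
    g ∈ glZariskiClosure (reflectionGroup B E) := by
  rcases h.of_orbit hB hBn hE hsp htr with hfin | hO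
  · exact absurd hfin hinf
  · exact (hO g).2 hg

/-- **Consumer form, as a characterisation**: under the hypotheses of `….of_orbit` with `M` infinite,
`M` is exactly the set of isometries. [cite: CarlsonToledo1999, §3 Theorem (Deligne) (held text p0007)]
[cite: Deligne1980, §4.4 Lemme (4.4.2^β) p. 228] -/
theorem Deligne1980_reflectionGroupClosure_finite_or_orthogonal.mem_iff_isometry_of_orbit_of_infinite
    (h : Deligne1980_reflectionGroupClosure_finite_or_orthogonal) {V : Type} [AddCommGroup V] [Module ℂ V]
    [FiniteDimensional ℂ V] {B : LinearMap.BilinForm ℂ V} (hB : B.IsSymm) (hBn : B.Nondegenerate)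
    {E : Set V} (hE : ∀ δ ∈ E, B δ δ = 2) (hsp : Submodule.span ℂ E = ⊤)
    (htr : ∀ δ ∈ E, ∀ δ' ∈ E, ∃ γ ∈ reflectionGroup B E, γ δ = δ')
    (hinf : (glZariskiClosure (reflectionGroup B E)).Infinite) (g : V ≃ₗ[ℂ] V) :
    g ∈ glZariskiClosure (reflectionGroup B E) ↔ ∀ x y : V, B (g x) (g y) = B x y :=
  ⟨fun hg => isometry_of_mem_glZariskiClosure_reflectionGroup B hB hE hg,
    fun hg => h.mem_of_isometry_of_orbit_of_infinite hB hBn hE hsp htr hinf hg⟩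

/-- **The infinitude test used in practice**: if two elements of `M` (e.g. two products of reflections)
generate infinitely many distinct powers — concretely, if some `u ∈ M` has infinite order (`u^i ≠ u^j` for
`i ≠ j`) — then `M` is infinite. [cite: Deligne1980, §4.4 (4.4.3^β) p. 228 ("`s_{δ'} s_{δ''}` est une rotation d'ordre infini")] -/
theorem infinite_glZariskiClosure_of_injective_pow {K : Type*} [Field K] {V : Type*} [AddCommGroup V]
    [Module K V] [FiniteDimensional K V] {Δ : Subgroup (V ≃ₗ[K] V)} {u : V ≃ₗ[K] V}
    (hu : u ∈ glZariskiClosure Δ) (hinj : Function.Injective fun n : ℕ => u ^ n) :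
    (glZariskiClosure Δ).Infinite := by
  have hpow : ∀ n : ℕ, u ^ n ∈ glZariskiClosure Δ := fun n =>
    (glZariskiClosureSubgroup Δ).pow_mem ((mem_glZariskiClosureSubgroup_iff Δ u).2 hu) n
  exact Set.infinite_of_injective_forall_mem hinj hpow

end Orbit

end Literature.AlgebraicGeometry.HodgeTheory

end
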